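import Literature.Probability.RandomPlanarGeometry.HexSAWStripWidthThreeHatRecursion
import HarnessLib

/-!
# The width-three strip: the COMPANION form of the hat recursion — every hat bridge sum of `S₃` is a block of a power of ONE explicit
# `24 × 24` matrix, `𝕊(k) = 𝔾₃^(k−1)·𝕊(1)`, with both critical Perron partners of `𝔾₃(y₃)` explicit (module «WIDTH-THREE HAT COMPANION»)

Topic `Literature/Probability/RandomPlanarGeometry` (continues «WIDTH-THREE HAT RECURSION» `HexSAWStripWidthThreeHatRecursion.lean` — `W3.hatD_three_rec :
D̂(k+4) = G₃D̂(k+3) + q(1+E′)D̂(k+1) − qG₃D̂(k)` (`k ≥ 1`, `q = x⁶y`), `W3.gThree`, `W3.ePrimeThree`, `W3.recSymbolOne_mulVec_uThree`, `W3.recSymbolOne_eq`,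
`W3.kerThree_eq_hat`, `W3.hatMZeroThree_mul_self`, `W3.sThree_mul_one_sub` — and uses «WIDTH-THREE-DENSITY» (`W3.uThree`, `W3.ellThree`,
`W3.ellThree_vecMul_kerThree`, `W3.detThree_stripYT_three`); the width-two model is «WIDTH-TWO HAT RECURSION» `W2.hatD_two_eq_pow : D̂(k) = G^(k−1)D̂(1)`).
Lane «pcv-sawmu» (CriticalPhenomena venture), a-p2 g28 — step 2 of the width-three contact-variance programme.  An order-four matrix recursion is a
first-order one on the stack of four consecutive terms; this module writes that companion form down with an explicit `24 × 24` block matrix `𝔾₃(y)`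
(indexed by `Fin 4 × Fin 6`), so that — exactly as at width two — every hat bridge sum of `S₃` is an entry of a matrix power, and exhibits the two
eigenvectors of `𝔾₃(y₃)` for the eigenvalue `1` in closed form (right: the stacked cofactor Perron vector `(u₃,u₃,u₃,u₃)`; left: the stack built from
`ℓ₃(1 − M̂(0))`), the data of the rank-one limit of `𝔾₃(y₃)^k`.  Sources of the SETTING: R. P. Stanley, EC1 (2012) §4.1 Theorem 4.1.1 (linear recurrences
with constant coefficients / transfer matrices); W. Feller I (1968) XIII.3 (renewal equation); E. Seneta (1973) §1.4 (Perron vectors); H. Duminil-Copin,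
A. Hammond, CMP 324 (2013) §2.2 (the bridge renewal structure).  Nothing below is printed.

## What is proved (namespace `Literature.Probability.RandomPlanarGeometry.SAW.HV.W3`; `x = x_c`, `q = x⁶y`, `y₃ = stripYT 3`, `s₃ = sThree`)

* §1 `hatStackThree y k` (the stack `𝕊(k)`, block `i` = `D̂(k+3−i)`), `stackBlockThree`, `companionBlockThree` / ★ `companionThree y` (`𝔾₃`: first block row
  `(G₃, 0, q(1+E′), −qG₃)`, then three shift rows), `companionThree_mul_apply` (block multiplication); ★★★ **`hatStack_three_succ (hy : 0 ≤ y) (hk : 1 ≤ k) :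
  hatStackThree y (k+1) = companionThree y * hatStackThree y k`**; ★★ **`hatStack_three_eq_pow : hatStackThree y k = companionThree y ^ (k−1) * hatStackThree y 1`**
  (`k ≥ 1`); `hatD_three_eq_stackBlock` (reading `D̂(k+3)`, `D̂(k)` off the stack).
* §2 `stackVecThree`, `companionThree_mulVec_stack_apply`; ★★ **`companionThree_mulVec_stack_uThree : 𝔾₃(y₃)·(u₃,u₃,u₃,u₃) = (u₃,u₃,u₃,u₃)`**.
* §3 `one_sub_hatMZero_mul_one_add` (`(1 − M̂(0))(1 + M̂(0)) = 1`); ★ `recSymbolOne_vecMul_of_fixed` (`ℓK₃ = ℓ`, `s(1−q) = q` ⇒ `ℓ(1−M̂(0))` is a left fixed covector of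
  `G₃ + q(1+E′) − qG₃`), `recSymbolOne_vecMul_ellThree` (at `(x_c, y₃)` with `ℓ₃ = ellThree s₃ y₃`); `stackCovecThree y w = (w, w(1−G₃), w(1−G₃), −q·wG₃)`,
  `stackCovec_vecMul_companionThree_apply`; ★★ **`stackCovec_vecMul_companionThree`** (`w(G₃ + q(1+E′) − qG₃) = w` ⇒ `W·𝔾₃ = W`) and
  ★★ `stackCovec_ellThree_vecMul_companionThree` — the explicit LEFT eigenvector of `𝔾₃(y₃)` for the eigenvalue `1`.

Label: LANE THEOREM (own result of lane «pcv-sawmu», a-p2 g28, 2026-08-28; not in print).  NOT claimed: simplicity of the eigenvalue `1` of `𝔾₃(y₃)`, the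
localisation of the other `23` eigenvalues inside the open unit disc (numerics of record: kit j300802, `HOME/pub-sawmu-a-p2/g28/hat3/kit/spectrum.py`),
the rank-one limit `𝔾₃(y₃)^k → V₃W₃/(W₃V₃)` and its rate, positivity of `W₃V₃` — the next car; the contact recursions and `σ₃²`.
-/

noncomputable section

open Finset Filter Topology Matrix Literature.Probability.LatticeModels Literature.Probability.Percolation

namespace Literature.Probability.RandomPlanarGeometry.SAW

namespace HV

namespace W3

/-! ## §1 The stacked state and the block companion matrix -/

/-- The stacked hat state `𝕊(k) = (D̂(k+3), D̂(k+2), D̂(k+1), D̂(k))` of `S₃`, a `(4·6) × 6` matrix: block row `i` is `D̂(k + 3 − i)`.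
[cite: Stanley2012EC1, §4.1 Theorem 4.1.1 (linear recurrences as first-order systems); lane «pcv-sawmu» a-p2 g28] -/
def hatStackThree (y : ℝ) (k : ℕ) : Matrix (Fin 4 × Fin (2 * 3)) (Fin (2 * 3)) ℝ :=
  Matrix.of fun p b => hatD 3 y (k + 3 - (p.1 : ℕ)) p.2 b

/-- Block `j` of a stacked `(4·6) × 6` matrix (plumbing). [cite: Stanley2012EC1, §4.1; lane plumbing] -/
def stackBlockThree (X : Matrix (Fin 4 × Fin (2 * 3)) (Fin (2 * 3)) ℝ) (j : Fin 4) : Matrix (Fin (2 * 3)) (Fin (2 * 3)) ℝ :=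
  Matrix.of fun c d => X (j, c) d

/-- The blocks of the stacked hat state are the hat sums (plumbing). [cite: Stanley2012EC1, §4.1; lane plumbing] -/
theorem stackBlock_hatStackThree (y : ℝ) (k : ℕ) (j : Fin 4) : stackBlockThree (hatStackThree y k) j = hatD 3 y (k + 3 - (j : ℕ)) := by
  ext c d; rfl

/-- The `6 × 6` blocks of the companion matrix: first block row `(G₃, 0, q(1 + E′), −qG₃)`, below it the three shift rows `(1,0,0,0)`, `(0,1,0,0)`,
`(0,0,1,0)` (`q = x⁶y`). [cite: Stanley2012EC1, §4.1 Theorem 4.1.1; lane «pcv-sawmu» a-p2 g28] -/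
def companionBlockThree (y : ℝ) (i j : Fin 4) : Matrix (Fin (2 * 3)) (Fin (2 * 3)) ℝ :=
  if (i : ℕ) = 0 then
    (if (j : ℕ) = 0 then gThree y else if (j : ℕ) = 2 then (hexCriticalFugacity ^ 6 * y) • (1 + ePrimeThree)
      else if (j : ℕ) = 3 then -((hexCriticalFugacity ^ 6 * y) • gThree y) else 0)
  else if (j : ℕ) + 1 = (i : ℕ) then 1 else 0

/-- ★ **The block companion matrix `𝔾₃(y)` of the width-three hat recursion** (a `24 × 24` real matrix indexed by `Fin 4 × Fin 6`).
[cite: Stanley2012EC1, §4.1 Theorem 4.1.1; Feller1968, XIII.3; lane «pcv-sawmu» a-p2 g28 — own] -/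
def companionThree (y : ℝ) : Matrix (Fin 4 × Fin (2 * 3)) (Fin 4 × Fin (2 * 3)) ℝ :=
  Matrix.of fun p r => companionBlockThree y p.1 r.1 p.2 r.2

/-- Block multiplication rule: `(𝔾₃ · 𝕏)_{(i,a) b} = Σ_j (block(i,j) · 𝕏_j)_{ab}` (plumbing). [cite: Stanley2012EC1, §4.1; lane plumbing] -/
theorem companionThree_mul_apply (y : ℝ) (X : Matrix (Fin 4 × Fin (2 * 3)) (Fin (2 * 3)) ℝ) (i : Fin 4) (a b : Fin (2 * 3)) :
    (companionThree y * X) (i, a) b = ∑ j : Fin 4, (companionBlockThree y i j * stackBlockThree X j) a b := by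
  rw [Matrix.mul_apply, Fintype.sum_prod_type]
  refine Finset.sum_congr rfl fun j _ => ?_
  rw [Matrix.mul_apply]
  rfl

/-- ★★★ **The companion form of the width-three hat recursion**: `𝕊(k+1) = 𝔾₃ · 𝕊(k)` for every `k ≥ 1` (`0 ≤ y`) — «WIDTH-THREE HAT RECURSION»'s
`D̂(k+4) = G₃D̂(k+3) + q(1+E′)D̂(k+1) − qG₃D̂(k)` in the first block row, shifts in the other three.
[cite: Stanley2012EC1, §4.1 Theorem 4.1.1; Feller1968, XIII.3; lane «pcv-sawmu» a-p2 g28 — own result, not in print] -/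
theorem hatStack_three_succ {y : ℝ} (hy : 0 ≤ y) {k : ℕ} (hk : 1 ≤ k) : hatStackThree y (k + 1) = companionThree y * hatStackThree y k := by
  have hrec := hatD_three_rec hy hk
  ext p b
  obtain ⟨i, a⟩ := p
  rw [companionThree_mul_apply, Fin.sum_univ_four, stackBlock_hatStackThree, stackBlock_hatStackThree, stackBlock_hatStackThree,
    stackBlock_hatStackThree]
  simp only [hatStackThree, Matrix.of_apply, companionBlockThree, Fin.val_zero, Fin.val_one, Fin.val_two, show ((3 : Fin 4) : ℕ) = 3 from rfl,
    Nat.sub_zero, show k + 3 - 1 = k + 2 by omega, show k + 3 - 2 = k + 1 by omega, show k + 3 - 3 = k by omega]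
  rw [← Matrix.smul_mul, ← Matrix.smul_mul] at hrec
  set Q : Matrix (Fin (2 * 3)) (Fin (2 * 3)) ℝ := (hexCriticalFugacity ^ 6 * y) • (1 + ePrimeThree) with hQ
  set R : Matrix (Fin (2 * 3)) (Fin (2 * 3)) ℝ := (hexCriticalFugacity ^ 6 * y) • gThree y with hR
  fin_cases i
  · norm_num [show k + 1 + 3 = k + 4 from rfl, hrec, Matrix.add_apply, Matrix.sub_apply, Matrix.neg_apply, Matrix.neg_mul]
    ring
  · norm_num [show k + 1 + 3 - 1 = k + 3 by omega]
  · norm_num [show k + 1 + 3 - 2 = k + 2 by omega]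
  · norm_num [show k + 1 + 3 - 3 = k + 1 by omega]

/-- ★★ **`𝕊(k) = 𝔾₃^(k−1) · 𝕊(1)` for every `k ≥ 1`**: every hat bridge sum `D̂(k)_{ab}` of the width-three strip (`k ≥ 1`) is an entry of a power of the
one explicit `24 × 24` matrix `𝔾₃(y)` applied to the four initial blocks `D̂(4), D̂(3), D̂(2), D̂(1)` — the form in which «WIDTH-TWO HAT CONVERGENCE»
consumed the width-two recursion. [cite: Stanley2012EC1, §4.1 Theorem 4.1.1; lane «pcv-sawmu» a-p2 g28 — own result] -/
theorem hatStack_three_eq_pow {y : ℝ} (hy : 0 ≤ y) {k : ℕ} (hk : 1 ≤ k) : hatStackThree y k = companionThree y ^ (k - 1) * hatStackThree y 1 := by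
  obtain ⟨m, rfl⟩ : ∃ m, k = m + 1 := ⟨k - 1, by omega⟩
  simp only [Nat.add_sub_cancel]
  induction m with
  | zero => simp
  | succ n ih => rw [hatStack_three_succ hy (by omega), ih (by omega), pow_succ', Matrix.mul_assoc]

/-- Reading the hat sums off the stacked state: `D̂(k+3) = block 0`, `D̂(k) = block 3` of `𝕊(k)` (plumbing). [cite: Stanley2012EC1, §4.1; lane plumbing] -/
theorem hatD_three_eq_stackBlock (y : ℝ) (k : ℕ) :
    hatD 3 y (k + 3) = stackBlockThree (hatStackThree y k) 0 ∧ hatD 3 y k = stackBlockThree (hatStackThree y k) 3 := by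
  rw [stackBlock_hatStackThree, stackBlock_hatStackThree]
  exact ⟨rfl, rfl⟩

/-! ## §2 The critical eigenvector of the companion matrix -/

/-- The stacked vector `(u, u, u, u)` (plumbing). [cite: Seneta1973, §1.4; lane plumbing] -/
def stackVecThree (u : Fin (2 * 3) → ℝ) : Fin 4 × Fin (2 * 3) → ℝ := fun p => u p.2

/-- Block rule for `𝔾₃` acting on a stacked vector (plumbing). [cite: Stanley2012EC1, §4.1; lane plumbing] -/
theorem companionThree_mulVec_stack_apply (y : ℝ) (u : Fin (2 * 3) → ℝ) (i : Fin 4) (a : Fin (2 * 3)) :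
    (companionThree y *ᵥ stackVecThree u) (i, a) = ∑ j : Fin 4, (companionBlockThree y i j *ᵥ u) a := by
  rw [Matrix.mulVec, dotProduct, Fintype.sum_prod_type]
  refine Finset.sum_congr rfl fun j _ => ?_
  rw [Matrix.mulVec, dotProduct]
  rfl

/-- ★★ **At criticality `λ = 1` is an eigenvalue of `𝔾₃` with the stacked Perron vector**: `𝔾₃(y₃)·(u₃,u₃,u₃,u₃) = (u₃,u₃,u₃,u₃)`, `u₃ = uThree s₃ y₃`
(block row `0` is «WIDTH-THREE HAT RECURSION»'s `recSymbolOne_mulVec_uThree`; the shift rows are trivial) — the constant stack is a fixed point of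
the companion dynamics, as the limit of `𝕊(k)` must be. [cite: Seneta1973, §1.4 (Perron vectors); Stanley2012EC1, §4.1; lane «pcv-sawmu» a-p2 g28 — own] -/
theorem companionThree_mulVec_stack_uThree :
    companionThree (stripYT 3) *ᵥ stackVecThree (uThree sThree (stripYT 3)) = stackVecThree (uThree sThree (stripYT 3)) := by
  have hfix := recSymbolOne_mulVec_uThree
  rw [Matrix.sub_mulVec, Matrix.add_mulVec] at hfix
  ext p
  obtain ⟨i, a⟩ := p
  rw [companionThree_mulVec_stack_apply, Fin.sum_univ_four]
  simp only [companionBlockThree, stackVecThree, Fin.val_zero, Fin.val_one, Fin.val_two, show ((3 : Fin 4) : ℕ) = 3 from rfl]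
  set Q : Matrix (Fin (2 * 3)) (Fin (2 * 3)) ℝ := (hexCriticalFugacity ^ 6 * stripYT 3) • (1 + ePrimeThree) with hQ
  set R : Matrix (Fin (2 * 3)) (Fin (2 * 3)) ℝ := (hexCriticalFugacity ^ 6 * stripYT 3) • gThree (stripYT 3) with hR
  fin_cases i
  · have h := congr_fun hfix a
    simp only [Pi.sub_apply, Pi.add_apply] at h
    norm_num [Matrix.neg_mulVec]
    linear_combination h
  · norm_num
  · norm_num
  · norm_num

/-! ## §3 The critical LEFT eigenvectors: `ℓ₃(1 − M̂(0))` for the symbol, and its stack for `𝔾₃` -/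

/-- `(1 − M̂(0))·(1 + M̂(0)) = 1` (`M̂(0)² = 0`; plumbing). [cite: Feller1968, XIII.3; lane plumbing] -/
theorem one_sub_hatMZero_mul_one_add : ((1 : Matrix (Fin (2 * 3)) (Fin (2 * 3)) ℝ) - hatMZeroThree) * (1 + hatMZeroThree) = 1 := by
  rw [Matrix.sub_mul, Matrix.one_mul, Matrix.mul_add, Matrix.mul_one, hatMZeroThree_mul_self]
  abel

/-- ★ **Left version of the symbol identity**: if `ℓ·K₃(s; y) = ℓ` and `s(1 − q) = q`, then `w₀ := ℓ·(1 − M̂(0))` is a LEFT fixed covector of the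
symbol at `λ = 1`: `w₀·(G₃ + q(1 + E′) − qG₃) = w₀`. [cite: Seneta1973, §1.4 (left Perron vectors); Feller1968, XIII.3; lane «pcv-sawmu» a-p2 g28 — own] -/
theorem recSymbolOne_vecMul_of_fixed {s y q : ℝ} {ℓ : Fin (2 * 3) → ℝ} (hl : ℓ ᵥ* kerThree s y = ℓ) (hs : s * (1 - q) = q) :
    (ℓ ᵥ* (1 - hatMZeroThree)) ᵥ* (gThree y + q • (1 + ePrimeThree) - q • gThree y) = ℓ ᵥ* (1 - hatMZeroThree) := by
  rw [kerThree_eq_hat, Matrix.vecMul_add, Matrix.vecMul_add, Matrix.vecMul_smul] at hl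
  have hb : ℓ ᵥ* hatMOneThree y = ℓ - ℓ ᵥ* hatMZeroThree - s • (ℓ ᵥ* eSerpThree) := by
    calc ℓ ᵥ* hatMOneThree y
        = (ℓ ᵥ* hatMZeroThree + ℓ ᵥ* hatMOneThree y + s • ℓ ᵥ* eSerpThree) - ℓ ᵥ* hatMZeroThree - s • (ℓ ᵥ* eSerpThree) := by abel
      _ = ℓ - ℓ ᵥ* hatMZeroThree - s • (ℓ ᵥ* eSerpThree) := by rw [hl]
  have hX : ℓ ᵥ* ((1 - q) • hatMOneThree y + q • (1 + eSerpThree - hatMZeroThree)) = ℓ ᵥ* (1 - hatMZeroThree) := by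
    rw [Matrix.vecMul_add, Matrix.vecMul_smul, Matrix.vecMul_smul, Matrix.vecMul_sub, Matrix.vecMul_add, Matrix.vecMul_one, hb,
      Matrix.vecMul_sub, Matrix.vecMul_one]
    ext i
    simp only [Pi.add_apply, Pi.smul_apply, Pi.sub_apply, smul_eq_mul]
    linear_combination (-(ℓ ᵥ* eSerpThree) i) * hs
  rw [recSymbolOne_eq, ← Matrix.vecMul_vecMul, Matrix.vecMul_vecMul ℓ, one_sub_hatMZero_mul_one_add, Matrix.vecMul_one, hX]

/-- `ℓ₃·(1 − q₃ … )`: at `(x_c, y₃)` the covector `w₃ := ℓ₃·(1 − M̂(0))` (`ℓ₃ = ellThree s₃ y₃`, the cofactor left Perron vector of «WIDTH-THREE-DENSITY»)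
is a left fixed covector of the recursion's symbol at `λ = 1`. [cite: Seneta1973, §1.4; lane «pcv-sawmu» a-p2 g28 — own] -/
theorem recSymbolOne_vecMul_ellThree :
    (ellThree sThree (stripYT 3) ᵥ* (1 - hatMZeroThree)) ᵥ*
        (gThree (stripYT 3) + (hexCriticalFugacity ^ 6 * stripYT 3) • (1 + ePrimeThree) - (hexCriticalFugacity ^ 6 * stripYT 3) • gThree (stripYT 3)) =
      ellThree sThree (stripYT 3) ᵥ* (1 - hatMZeroThree) :=
  recSymbolOne_vecMul_of_fixed (ellThree_vecMul_kerThree detThree_stripYT_three) sThree_mul_one_sub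

/-- The stacked LEFT covector `(w₀, w₀(1 − G₃), w₀(1 − G₃), −q·w₀G₃)` attached to a covector `w₀` (plumbing; this is the shape of a left eigenvector of a
block companion matrix for the eigenvalue `1`). [cite: Stanley2012EC1, §4.1; lane plumbing] -/
def stackCovecThree (y : ℝ) (w : Fin (2 * 3) → ℝ) : Fin 4 × Fin (2 * 3) → ℝ := fun p =>
  if (p.1 : ℕ) = 0 then w p.2 else if (p.1 : ℕ) = 3 then -((hexCriticalFugacity ^ 6 * y) • (w ᵥ* gThree y)) p.2 else (w ᵥ* (1 - gThree y)) p.2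

/-- Block rule for a stacked covector acting on `𝔾₃` (plumbing). [cite: Stanley2012EC1, §4.1; lane plumbing] -/
theorem stackCovec_vecMul_companionThree_apply (y : ℝ) (w : Fin (2 * 3) → ℝ) (j : Fin 4) (b : Fin (2 * 3)) :
    (stackCovecThree y w ᵥ* companionThree y) (j, b) =
      ∑ i : Fin 4, ((fun c => stackCovecThree y w (i, c)) ᵥ* companionBlockThree y i j) b := by
  rw [Matrix.vecMul, dotProduct, Fintype.sum_prod_type]
  refine Finset.sum_congr rfl fun i _ => ?_
  rw [Matrix.vecMul, dotProduct]
  rfl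

/-- ★★ **The LEFT eigenvector of `𝔾₃` for the eigenvalue `1`**: whenever `w₀·(G₃ + q(1+E′) − qG₃) = w₀`, the stacked covector
`W = (w₀, w₀(1 − G₃), w₀(1 − G₃), −q·w₀G₃)` satisfies `W·𝔾₃ = W`; with `recSymbolOne_vecMul_ellThree` this gives, at criticality, the explicit left
partner of `companionThree_mulVec_stack_uThree` — the two vectors spanning the rank-one limit of `𝔾₃(y₃)^k` (next car).
[cite: Seneta1973, §1.4; Stanley2012EC1, §4.1 Theorem 4.1.1; lane «pcv-sawmu» a-p2 g28 — own] -/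
theorem stackCovec_vecMul_companionThree {y : ℝ} {w : Fin (2 * 3) → ℝ}
    (hw : w ᵥ* (gThree y + (hexCriticalFugacity ^ 6 * y) • (1 + ePrimeThree) - (hexCriticalFugacity ^ 6 * y) • gThree y) = w) :
    stackCovecThree y w ᵥ* companionThree y = stackCovecThree y w := by
  rw [Matrix.vecMul_sub, Matrix.vecMul_add, Matrix.vecMul_smul, Matrix.vecMul_smul] at hw
  ext p
  obtain ⟨j, b⟩ := p
  rw [stackCovec_vecMul_companionThree_apply, Fin.sum_univ_four]
  simp only [companionBlockThree, stackCovecThree, Fin.val_zero, Fin.val_one, Fin.val_two, show ((3 : Fin 4) : ℕ) = 3 from rfl]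
  have e0 : (fun c : Fin (2 * 3) => w c) = w := rfl
  fin_cases j
  · -- column block 0: w·G + w(1 − G) = w
    norm_num [e0]
    simp only [Matrix.vecMul_sub, Matrix.vecMul_one, Pi.sub_apply]
    ring
  · -- column block 1: (w(1−G))·1 = w(1−G)
    norm_num
  · -- column block 2: w·q(1+E′) − q·wG = w(1 − G)
    norm_num [e0]
    have h := congr_fun hw b
    simp only [Pi.sub_apply, Pi.add_apply, Pi.smul_apply, smul_eq_mul, Matrix.vecMul_add, Matrix.vecMul_one] at h
    simp only [Matrix.vecMul_add, Matrix.vecMul_smul, Matrix.vecMul_sub, Matrix.vecMul_one, Pi.add_apply, Pi.sub_apply, Pi.smul_apply,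
      smul_eq_mul]
    linear_combination h
  · -- column block 3: w·(−qG) = −q·wG
    norm_num [e0, Matrix.vecMul_smul, Matrix.vecMul_neg]

/-- ★★ **At criticality, both Perron partners of `𝔾₃(y₃)` for the eigenvalue `1` are explicit**: the stacked covector built from `w₃ = ℓ₃(1 − M̂(0))` is a
left eigenvector, `W₃·𝔾₃(y₃) = W₃` (with `companionThree_mulVec_stack_uThree` the right one). [cite: Seneta1973, §1.4; Stanley2012EC1, §4.1; lane «pcv-sawmu» a-p2 g28 — own] -/
theorem stackCovec_ellThree_vecMul_companionThree :
    stackCovecThree (stripYT 3) (ellThree sThree (stripYT 3) ᵥ* (1 - hatMZeroThree)) ᵥ* companionThree (stripYT 3) =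
      stackCovecThree (stripYT 3) (ellThree sThree (stripYT 3) ᵥ* (1 - hatMZeroThree)) :=
  stackCovec_vecMul_companionThree recSymbolOne_vecMul_ellThree

end W3

end HV

end Literature.Probability.RandomPlanarGeometry.SAW
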